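import Literature.LinearAlgebra.Alternating.WedgeWordsSorted
import Mathlib.LinearAlgebra.LinearIndependent.Defs
import Mathlib.LinearAlgebra.Basis.Basic
import Mathlib.LinearAlgebra.Dimension.StrongRankCondition
import HarnessLib

/-!
# The increasing wedge monomials of a dual frame form a basis (Warner (1983), 2.6)

Completion of `Literature/LinearAlgebra/Alternating/WedgeWords.lean` (spanning),
`WedgeWordsDet.lean` (determinant formula) and `WedgeWordsSorted.lean` (increasing words suffice):
for a **dual frame** — `1`-forms `θᵢ : E →L[𝕜] 𝕜` and vectors `vᵢ`, `i ∈ ι'` linearly ordered, with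
`Σᵢ θᵢ(·) vᵢ = id` and `θᵢ(vⱼ) = δᵢⱼ` — and the constant `0`-form `1`:

* `frameWord_apply_comp_strictMono` (`frameWord 𝕜' θ₀ k w = θ_w ∧ 1`, the `𝕜'`-valued monomial): for strictly increasing words `w, w'`,
  `(θ_w ∧ 1)(v_{w' 0}, …, v_{w' (k-1)}) = δ_{w,w'}` (the pairing matrix is the identity for `w = w'`
  and has a zero row otherwise);
* `linearIndependent_frameWord_strictMono`: the `θ_w ∧ 1`, `w` strictly increasing, are linearly
  independent;
* `frameWordBasis`: they form a `𝕜'`-basis of `E [⋀^Fin k]→L[𝕜] 𝕜'` — Warner (1983), 2.6: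
  "`{θ_{i₁} ∧ ⋯ ∧ θ_{i_k} : i₁ < ⋯ < i_k}` is a basis of `Λ_k(V*)`"; Lange–Birkenhake (1992),
  Prop. 1.1.20 pointwise ("the `dx_{i₁} ∧ ⋯ ∧ dx_{i_n}`, `i₁ < ⋯ < i_n`, form a basis").

## References

* F. W. Warner, *Foundations of Differentiable Manifolds and Lie Groups* (1983), 2.6. [Warner1983]
* H. Lange, Ch. Birkenhake, *Complex Abelian Varieties* (1992), §1.1.4 Prop. 1.1.20.
  [LangeBirkenhake1992]
-/

noncomputable section

open ContinuousAlternatingMap Function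

namespace Literature.LinearAlgebra.Alternating

variable {𝕜 : Type*} [NontriviallyNormedField 𝕜] {𝕜' : Type*} [NormedField 𝕜']
  [NormedAlgebra 𝕜 𝕜'] {E : Type*} [NormedAddCommGroup E] [NormedSpace 𝕜 E]
  {F : Type*} [NormedAddCommGroup F] [NormedSpace 𝕜 F] [NormedSpace 𝕜' F]
  [IsScalarTower 𝕜 𝕜' F]

/-- If some entry of `u` pairs to zero with every letter of `w` (a zero column), the monomial vanishes
on `u`. [cite: Warner1983, 2.6] -/
theorem wedgeWord_apply_eq_zero_of_col {σ : Type*} (θ : σ → (E →L[𝕜] 𝕜')) (c : E [⋀^Fin 0]→L[𝕜] F)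
    {k : ℕ} (w : Fin k → σ) (u : Fin k → E) (j : Fin k) (h : ∀ i, θ (w i) (u j) = 0) :
    wedgeWord θ c k w u = 0 := by
  have hdet : (pairingMatrix θ w u).det = 0 :=
    Matrix.det_eq_zero_of_column_eq_zero j fun i ↦ by rw [pairingMatrix_apply, h]
  rw [wedgeWord_apply, hdet, zero_smul]

section DualFrame

variable {ι' : Type*}

variable (𝕜') in
/-- The increasing monomial `θ_{w 0} ∧ ⋯ ∧ θ_{w (k-1)} ∧ 1` of a frame `θ₀`, `𝕜'`-valued.
[cite: Warner1983, 2.6] -/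
def frameWord (θ₀ : ι' → (E →L[𝕜] 𝕜)) (k : ℕ) (w : Fin k → ι') : E [⋀^Fin k]→L[𝕜] 𝕜' :=
  wedgeWord (fun i ↦ (θ₀ i).smulRight (1 : 𝕜'))
    (ContinuousAlternatingMap.constOfIsEmpty 𝕜 E (Fin 0) (1 : 𝕜')) k w

/-- Unfolding of `frameWord`. [folklore] -/
theorem frameWord_eq (θ₀ : ι' → (E →L[𝕜] 𝕜)) (k : ℕ) (w : Fin k → ι') :
    frameWord 𝕜' θ₀ k w = wedgeWord (fun i ↦ (θ₀ i).smulRight (1 : 𝕜'))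
      (ContinuousAlternatingMap.constOfIsEmpty 𝕜 E (Fin 0) (1 : 𝕜')) k w := rfl

variable [LinearOrder ι'] (θ₀ : ι' → (E →L[𝕜] 𝕜)) (v : ι' → E)
  (hdual : ∀ i j, θ₀ i (v j) = if i = j then 1 else 0)

include hdual in
/-- Duality in `𝕜'`: `(θᵢ · 1)(vⱼ) = δᵢⱼ`. [folklore] -/
theorem smulRight_one_apply_v (i j : ι') :
    (θ₀ i).smulRight (1 : 𝕜') (v j) = if i = j then (1 : 𝕜') else 0 := by
  simp only [ContinuousLinearMap.smulRight_apply, hdual]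
  split_ifs <;> simp

include hdual in
/-- **Values on dual tuples.** For strictly increasing words `w, w'`,
`(θ_w ∧ 1)(v_{w' 0}, …, v_{w' (k-1)}) = δ_{w,w'}`. [cite: Warner1983, 2.6] -/
theorem frameWord_apply_comp_strictMono {k : ℕ} {w w' : Fin k → ι'} (hw : StrictMono w)
    (hw' : StrictMono w') :
    frameWord 𝕜' θ₀ k w (v ∘ w') = if w = w' then (1 : 𝕜') else 0 := by
  rw [frameWord_eq]
  split_ifs with h
  · subst h
    rw [wedgeWord_apply_of_dual]
    · rfl
    · intro i j
      rw [comp_apply, smulRight_one_apply_v θ₀ v hdual]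
      simp only [hw.injective.eq_iff]
  · -- the ranges differ: some letter of `w` is not a letter of `w'` (zero row) or conversely (zero column)
    have hne : Set.range w ≠ Set.range w' := fun hr ↦ h ((hw.range_inj hw').1 hr)
    by_cases hsub : Set.range w ⊆ Set.range w'
    · have hsub' : ¬ Set.range w' ⊆ Set.range w := fun h' ↦ hne (Set.Subset.antisymm hsub h')
      simp only [Set.subset_def, Set.mem_range, not_forall, not_exists, forall_exists_index,
        forall_apply_eq_imp_iff] at hsub'
      obtain ⟨j, hj⟩ := hsub'
      refine wedgeWord_apply_eq_zero_of_col _ _ w (v ∘ w') j fun i ↦ ?_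
      rw [comp_apply, smulRight_one_apply_v θ₀ v hdual, if_neg fun h' ↦ hj i h']
    · simp only [Set.subset_def, Set.mem_range, not_forall, not_exists, forall_exists_index,
        forall_apply_eq_imp_iff] at hsub
      obtain ⟨i, hi⟩ := hsub
      refine wedgeWord_apply_eq_zero_of_row _ _ w (v ∘ w') i fun j ↦ ?_
      rw [comp_apply, smulRight_one_apply_v θ₀ v hdual, if_neg fun h' ↦ hi j h'.symm]

include hdual in
/-- **The increasing monomials are linearly independent** (evaluate a vanishing combination on the dual
tuples). [cite: Warner1983, 2.6] -/
theorem linearIndependent_frameWord_strictMono (k : ℕ) :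
    LinearIndependent 𝕜' (fun w : {w : Fin k → ι' // StrictMono w} ↦ frameWord 𝕜' θ₀ (E := E) k w.1) := by
  rw [linearIndependent_iff']
  intro s g hg w hw
  have h := congrArg (fun f : E [⋀^Fin k]→L[𝕜] 𝕜' ↦ f (v ∘ w.1)) hg
  simp only [ContinuousAlternatingMap.sum_apply, ContinuousAlternatingMap.smul_apply,
    ContinuousAlternatingMap.coe_zero, Pi.zero_apply] at h
  rw [Finset.sum_eq_single w] at h
  · simpa [frameWord_apply_comp_strictMono θ₀ v hdual w.2 w.2] using h
  · intro w' _ hw'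
    rw [frameWord_apply_comp_strictMono θ₀ v hdual w'.2 w.2,
      if_neg fun h' ↦ hw' (Subtype.ext h'), smul_zero]
  · intro hws
    exact absurd hw hws

variable [Fintype ι'] [CharZero 𝕜']
  (hframe : ∑ i, (θ₀ i).smulRight (v i) = ContinuousLinearMap.id 𝕜 E)

include hframe in
/-- **The increasing monomials span** (`span_wedgeWord_const_eq_top` with
`span_wedgeWord_image_eq_span_strictMono`). [cite: Warner1983, 2.6] -/
theorem span_frameWord_strictMono_eq_top (k : ℕ) :
    Submodule.span 𝕜' (Set.range fun w : {w : Fin k → ι' // StrictMono w} ↦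
      frameWord 𝕜' θ₀ (E := E) k w.1) = ⊤ := by
  have htop := span_wedgeWord_const_eq_top (𝕜' := 𝕜') θ₀ v hframe k
  rw [wedgeWordSpan, ← Set.image_univ,
    span_wedgeWord_image_eq_span_strictMono _ _ (fun w _ π ↦ Set.mem_univ (w ∘ π))] at htop
  rw [← htop]
  congr 1
  ext η
  simp only [Set.mem_range, Subtype.exists, Set.mem_image, Set.mem_setOf_eq, Set.mem_univ, true_and,
    frameWord_eq]
  constructor
  · rintro ⟨w, hw, rfl⟩; exact ⟨w, hw, rfl⟩
  · rintro ⟨w, hw, rfl⟩; exact ⟨w, hw, rfl⟩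

include hdual hframe in
/-- **The basis of increasing monomials** of `E [⋀^Fin k]→L[𝕜] 𝕜'` (Warner (1983), 2.6;
Lange–Birkenhake (1992), Prop. 1.1.20 pointwise). [cite: Warner1983, 2.6] -/
def frameWordBasis (k : ℕ) :
    Module.Basis {w : Fin k → ι' // StrictMono w} 𝕜' (E [⋀^Fin k]→L[𝕜] 𝕜') :=
  Module.Basis.mk (linearIndependent_frameWord_strictMono θ₀ v hdual k)
    (span_frameWord_strictMono_eq_top θ₀ v hframe k).ge

include hdual hframe in
/-- The basis vectors are the increasing monomials. [cite: Warner1983, 2.6] -/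
@[simp] theorem frameWordBasis_apply (k : ℕ) (w : {w : Fin k → ι' // StrictMono w}) :
    frameWordBasis θ₀ v hdual hframe k w = frameWord 𝕜' θ₀ (E := E) k w.1 := by
  rw [frameWordBasis, Module.Basis.mk_apply]

include hdual hframe in
/-- **Dimension count**: `dim_{𝕜'} Λᵏ = #{increasing words of length k}` (`= C(#ι', k)`).
[cite: Warner1983, 2.6] -/
theorem finrank_eq_card_strictMono (k : ℕ) :
    Module.finrank 𝕜' (E [⋀^Fin k]→L[𝕜] 𝕜') = Fintype.card {w : Fin k → ι' // StrictMono w} :=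
  Module.finrank_eq_card_basis (frameWordBasis θ₀ v hdual hframe k)

end DualFrame

end Literature.LinearAlgebra.Alternating

end
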